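import Mathlib.Data.Matrix.Basic
import Mathlib.Data.Real.Basic
import Mathlib.Tactic
import HarnessLib

/-!
# Hintz 2026, §5.2–5.4 (exterior region): the 𝓘⁺-normal-operator matrix `A_h` versus its refereed model
# [Hintz2023] Prop 3.29, and the printed parameter / weight windows of Thm 5.17 (transcription + bookkeeping)

CITATION HEADER (lean-in-tree rule 2026-08-18).  P. Hintz, *Nonlinear stability of subextremal Kerr black
holes*, arXiv:2606.28253 **v2** (2026-08-03), bib key `Hintz2026` — an UNREFEREED CLAIM under adjudication in
this library.  TeX line numbers `l.N` refer to the v2 source `kerr-stab-r.tex`.  The refereed comparison source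
is P. Hintz, *Exterior stability of Minkowski space in generalized harmonic gauge*, Arch. Ration. Mech. Anal.
**247** (2023) no. 5, art. 99 = arXiv:2302.13804 ("[HintzMink4Gauge]" in Hintz 2026), bib `Hintz2023`; TeX line
numbers `HM l.N` refer to its e-print `mink4-gauge.tex`.  This module is the audit cell `pub-kerr`'s HINTZ-PLAN
item R7 (refereed half) / P14: Hintz 2026 proves Thm 5.17 (`ThmEx0`, exterior solution) by asserting that "the
proof is the same (with minor, only notational, modifications) as that of [HintzMink4Gauge, Corollary 3.36]"
(l.5266) and that the structure (5.x) `EqExOpLinebNormal` of the linearised gauge-fixed Einstein operator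
"matches [HintzMink4Gauge, Proposition 3.29], keeping in mind also the weights in [HintzMink4Gauge, Definition
3.27]" (l.5278).  We TRANSCRIBE the two printed 7×7 endomorphisms — Hintz 2026 eq. `EqExOpLinAhBh` (l.5006–5016,
the matrix `A_h` on Kerr with the constraint-damping / gauge data `(v^𝓒, e^𝓒, γ^𝓒; e^Υ, γ^Υ)`) and [Hintz2023]
Prop 3.29 (HM l.1786–1796, `A_{g,E^𝓒,E^Υ}` on Schwarzschild with `γ^𝓒 ∈ (0,1)`, `γ^Υ ∈ (−1,0)`) — as matrices
over a field of SYMBOLS (a field only because two printed entries carry a factor `½`) (the `h`-dependent entries `∂₁(r h_{01})`, `∂₁(r h_1{}^{ā})`, `∂₁(r h_{1ā})`,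
`∂₁(r h^{āb̄})`, `∂₁(r h_{āb̄})` are opaque symbols; the comparison is positional, entry by entry, in the common
7-block splitting `EqKNullS2TFine` / HM `EqNMVbSplit`), and PROVE:
* `hintzA_specializes_to_hm4g` — at `(v^𝓒, e^𝓒, e^Υ) = (0, 0, 0)`, with the sign convention
  `γ^Υ_[Hintz2023] = −γ^Υ_[Hintz2026]`, with [Hintz2023]'s `h = r·h_[Hintz2026]` (its metric is `g_𝔪 + r^{-1}h`,
  HM Def 3.20), and with the three `h`-entries that [Hintz2023] does not carry in `A` (`(2,1)`, `(4,3)`, `(4,6)`,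
  `(5,1)` of Hintz 2026 carry `±2∂₁(r h_{01})`, `2∂₁(r h_1{}^{ā})`, `2∂₁(r h_{1ā})`) set to zero, Hintz 2026's
  `A_h` IS [Hintz2023]'s matrix — i.e. "matches" holds literally on the common parameter range, and the Kerr /
  general-parameter version is a strict generalisation (more parameters, four more `h`-entries);
* `hintzA_diag` — the diagonal of `A_h` (its eigenvalues: the matrix is lower triangular in the reordered
  splitting (EqExOpLinSplit), l.4764–4770 — "in a certain permutation of the summands of (EqKNullS2TFine)",
  l.4368 — namely the block permutation `[0,2,5,1,4,6,3]`, under which the three super-diagonal entries `(2,6)`,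
  `(4,6)`, `(4,7)` of the present (EqKNullS2TFine) transcription move below the diagonal; kernel-checked in the
  companion `Hintz2026/ForwardSolutionDictionary.lean`, `exA_eq_submatrix` / `exA_lower`) is `(2(1−v^𝓒)γ^𝓒,
  (1−e^Υ)γ^Υ, (1−v^𝓒)γ^𝓒, 2γ^Υ, γ^Υ, (1−e^𝓒)(1−v^𝓒)γ^𝓒, 0)` as the text lists (l.5061, l.5131);
* `diag_pos_of_param` — the printed parameter conditions (5.x) `EqExOpParam` (l.5057–5059: `v^𝓒 < 1`,
  `0 < e^𝓒 < 1`, `γ^𝓒 > 0`, `0 < e^Υ < 1`, `γ^Υ > 0`) make the six nonzero diagonal entries positive ("Conditions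
  ensuring at least `𝒪(ρ_𝒥)` decay are, therefore, …", l.5056);
* `ells_window_nonempty` — the weight window (5.x) `EqEx0ells` (l.5176–5179: `ℓ₀^♭ > 1`,
  `1 < ℓ_𝒥^♭ < min(ℓ₀^♭, 1 + (1−e^Υ)γ^Υ, 3/2)`) is inhabited exactly when `ℓ₀^♭ > 1` and `(1−e^Υ)γ^Υ > 0`, and is
  [Hintz2023]'s window (HM Cor 3.36: `ℓ₀ > 0`, `ℓ_𝒥 ∈ (0, min(ℓ₀, ½))`; HM Def 3.20: `ℓ_𝒥 < min(−γ^Υ, ℓ₀, ½)`)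
  SHIFTED BY ONE (`ℓ^♭ = ℓ + 1`, the `r^{-1}` prefactor of HM's perturbation) with `−γ^Υ_[HM] ↔ (1−e^Υ)γ^Υ`:
  `hm4g_window_shift`.
Nothing here asserts that these matrices ARE the normal operators of the respective linearised operators (that is
the content of Hintz 2026 Lemma 5.x / [Hintz2023] Prop 3.29's proofs), nor anything about the estimates; no named
facts (D-0026).  Companion: `Hintz2026/NashMoserInterface.lean` §2b ([Hintz2023] Thm 3.35 / Cor 3.36, `d = 11`,
`2433`).

## References
* P. Hintz, arXiv:2606.28253v2 (2026), §5.2 eq. (EqExOpLinAhBh) l.5006–5016, (EqExOpParam) l.5057–5059,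
  (EqEx0ells) l.5176–5179, Thm 5.17 l.5235–5253 and its proof l.5264–5280. [Hintz2026]
* P. Hintz, Arch. Ration. Mech. Anal. 247 (2023) art. 99 = arXiv:2302.13804, Def 3.20, Def 3.27, Prop 3.29,
  Thm 3.35, Cor 3.36. [Hintz2023]
-/

namespace Literature.Geometry.Lorentzian

namespace Hintz2026.ExteriorNormalOperator

open Matrix

variable {R : Type*} [Field R]

/-- **Hintz 2026, `A_h` of eq. (EqExOpLinAhBh)** (l.5006–5016), transcribed positionally in the 7-block splitting
`EqKNullS2TFine`; parameters `v e γ` = `(v^𝓒, e^𝓒, γ^𝓒)`, `eU γU` = `(e^Υ, γ^Υ)`; symbols `a = ∂₁(r h_{01})`,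
`b = ∂₁(r h_1{}^{ā})`, `c = ∂₁(r h_{1ā})`, `dd = ∂₁(r h^{āb̄})`, `ee = ∂₁(r h_{āb̄})`.  Printed rows:
`(2(1−v)γ,0,…)`, `(e(1+v)γ+γU+2a, (1−eU)γU, 0,0,0, ½(e(1−v)γ+eU γU), 0)`, `(0,0,(1−v)γ,0,…)`,
`(0, 2(1−eU)γU, 2b, 2γU, 0, (1+v)γ+eU γU−2a, −½dd)`, `(2c, 0, (1+v)γ+γU, 0, γU, 0, 0)`,
`(2(1−e)(1+v)γ, 0,0,0,0, (1−e)(1−v)γ, 0)`, `(2ee, 0,…,0)`.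
[cite: Hintz2026, eq. (EqExOpLinAhBh) TeX l.5006-5016 (transcription; claim under review)] -/
def hintzA (v e γ eU γU a b c dd ee : R) : Matrix (Fin 7) (Fin 7) R :=
  !![2 * (1 - v) * γ, 0, 0, 0, 0, 0, 0;
     e * (1 + v) * γ + γU + 2 * a, (1 - eU) * γU, 0, 0, 0, (e * (1 - v) * γ + eU * γU) / 2, 0;
     0, 0, (1 - v) * γ, 0, 0, 0, 0;
     0, 2 * (1 - eU) * γU, 2 * b, 2 * γU, 0, (1 + v) * γ + eU * γU - 2 * a, -(dd / 2);
     2 * c, 0, (1 + v) * γ + γU, 0, γU, 0, 0;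
     2 * (1 - e) * (1 + v) * γ, 0, 0, 0, 0, (1 - e) * (1 - v) * γ, 0;
     2 * ee, 0, 0, 0, 0, 0, 0]

/-- **[Hintz2023] Prop 3.29, `A_{g,E^𝓒,E^Υ}`** (HM l.1786–1796), transcribed positionally in the splitting
`EqNMVbSplit`; parameters `γC = γ^𝓒 ∈ (0,1)`, `γUhm = γ^Υ ∈ (−1,0)` (HM Def 3.27, l.1748); symbols
`dd = ∂₁h^{āb̄}`, `ee = ∂₁h_{āb̄}` for HM's `h` (`= r·h` of Hintz 2026).  Printed rows: `(2γC,0,…)`,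
`(−γU,−γU,0,…)`, `(0,0,γC,0,…)`, `(0,−2γU,0,−2γU,0,γC,−½dd)`, `(0,0,γC−γU,0,−γU,0,0)`, `(2γC,0,0,0,0,γC,0)`,
`(2ee,0,…,0)`. [cite: Hintz2023, Prop 3.29 (PropNELin) e-print TeX l.1774-1812] -/
def hm4gA (γC γUhm dd ee : R) : Matrix (Fin 7) (Fin 7) R :=
  !![2 * γC, 0, 0, 0, 0, 0, 0;
     -γUhm, -γUhm, 0, 0, 0, 0, 0;
     0, 0, γC, 0, 0, 0, 0;
     0, -(2 * γUhm), 0, -(2 * γUhm), 0, γC, -(dd / 2);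
     0, 0, γC - γUhm, 0, -γUhm, 0, 0;
     2 * γC, 0, 0, 0, 0, γC, 0;
     2 * ee, 0, 0, 0, 0, 0, 0]

/-- **"matches [HintzMink4Gauge, Proposition 3.29]" (l.5278), made literal.**  On the common parameter range —
`v^𝓒 = e^𝓒 = e^Υ = 0`, `γ^Υ_[Hintz2023] = −γ^Υ_[Hintz2026]` (opposite sign conventions: HM Def 3.27 takes
`γ^Υ ∈ (−1,0)`, Hintz 2026 takes `γ^Υ > 0`), the same symbols `dd`, `ee` (HM's `h` is `r` times Hintz's) — and
with the three extra `h`-symbols `a, b, c` of Hintz 2026 (entries `(2,1)`, `(4,3)`, `(4,6)`, `(5,1)`, not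
carried in [Hintz2023]'s `A`) set to `0`, the two printed matrices coincide entry by entry.
[cite: Hintz2026, eq. (EqExOpLinAhBh) l.5006-5016 and l.5278; Hintz2023, Prop 3.29] -/
theorem hintzA_specializes_to_hm4g (γ γU dd ee : R) :
    hintzA 0 0 γ 0 γU 0 0 0 dd ee = hm4gA γ (-γU) dd ee := by
  ext i j
  fin_cases i <;> fin_cases j <;> simp [hintzA, hm4gA]

/-- The diagonal of `A_h` as listed in the text (l.5061: "the corresponding eigenvalues `2(1−v^𝓒)γ^𝓒`,
`(1−v^𝓒)γ^𝓒`, `(1−e^𝓒)(1−v^𝓒)γ^𝓒` … the largest remaining eigenvalue (… `2γ^Υ`)"; l.5131: "(4,4)-entry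
`1+(1−e^Υ)γ^Υ` of `I+A_h` … (5,5)-, resp. (6,6)-entry `1+γ^Υ`, resp. `1`" in the splitting (EqExOpLinSplit),
which permutes the blocks).  In the transcription order: `(2(1−v)γ, (1−eU)γU, (1−v)γ, 2γU, γU, (1−e)(1−v)γ, 0)`.
[cite: Hintz2026, l.5061 and l.5131] -/
theorem hintzA_diag (v e γ eU γU a b c dd ee : R) :
    (fun i => hintzA v e γ eU γU a b c dd ee i i) =
      ![2 * (1 - v) * γ, (1 - eU) * γU, (1 - v) * γ, 2 * γU, γU, (1 - e) * (1 - v) * γ, 0] := by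
  funext i
  fin_cases i <;> simp [hintzA]

/-- In the (EqKNullS2TFine) ordering used for this transcription, every entry `(i, j)` of `A_h` with `j > i` is
`0` except at the three positions `(2,6)`, `(4,6)`, `(4,7)` (1-indexed; entries `½(e^𝓒(1−v^𝓒)γ^𝓒+e^Υγ^Υ)`,
`(1+v^𝓒)γ^𝓒+e^Υγ^Υ−2∂₁(r h_{01})`, `−½∂₁(r h^{āb̄})`) — recorded as the explicit list of nonzero super-diagonal
positions.  These are exactly the entries that the block permutation `[0,2,5,1,4,6,3]` to the splitting
(EqExOpLinSplit) (l.4764) moves below the diagonal: there "the operator `A_h` is lower triangular and `B_h` is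
strictly lower triangular" (l.4770) holds literally (kernel: `Hintz2026/ForwardSolutionDictionary.exA_lower`,
`exB_strictLower`, `exA_eq_submatrix`).  (VERSION 2, docstring only: v1 glossed these three entries as "`h`-error
entries … which the text treats as error terms" and l.4770's splitting as "coarser" — both imprecise: one of the
three is an `(e,γ)`-entry, and (EqExOpLinSplit) is a reordering of the same seven summands; the theorem is
unchanged.) [cite: Hintz2026, l.4368, l.4764-4770 and eq. (EqExOpLinAhBh) l.5005-5016] -/
theorem hintzA_superdiag (v e γ eU γU a b c dd ee : R) (i j : Fin 7) (hij : i < j)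
    (h26 : (i, j) ≠ (1, 5)) (h46 : (i, j) ≠ (3, 5)) (h47 : (i, j) ≠ (3, 6)) :
    hintzA v e γ eU γU a b c dd ee i j = 0 := by
  fin_cases i <;> fin_cases j <;> simp_all [hintzA]

/-- **The printed parameter conditions (5.x) `EqExOpParam` give positive decay exponents**: under `v^𝓒 < 1`,
`0 < e^𝓒 < 1`, `γ^𝓒 > 0`, `0 < e^Υ < 1`, `γ^Υ > 0` (l.5057–5059) the six nonzero diagonal entries of `A_h` are
positive ("Conditions ensuring at least `𝒪(ρ_𝒥)` decay are, therefore, …", l.5056).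
[cite: Hintz2026, eq. (EqExOpParam) TeX l.5056-5059] -/
theorem diag_pos_of_param {v e γ eU γU : ℝ} (hv : v < 1) (he1 : e < 1) (hγ : 0 < γ)
    (heU1 : eU < 1) (hγU : 0 < γU) :
    0 < 2 * (1 - v) * γ ∧ 0 < (1 - eU) * γU ∧ 0 < (1 - v) * γ ∧ 0 < 2 * γU ∧ 0 < γU ∧
      0 < (1 - e) * (1 - v) * γ := by
  have h1 : 0 < 1 - v := by linarith
  have h2 : 0 < 1 - eU := by linarith
  have h3 : 0 < 1 - e := by linarith
  refine ⟨by positivity, by positivity, by positivity, by positivity, hγU, by positivity⟩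

/-- The "π^𝓒 decays faster" requirement (l.5061: "so `(1−e^𝓒)(1−v^𝓒)γ^𝓒 > 2γ^Υ`"): under `EqExOpParam` the
smallest `𝓒`-eigenvalue is `(1−e^𝓒)(1−v^𝓒)γ^𝓒` (it is `≤ (1−v^𝓒)γ^𝓒 ≤ 2(1−v^𝓒)γ^𝓒`) and the largest remaining one
is `2γ^Υ` (`≥ γ^Υ ≥ (1−e^Υ)γ^Υ ≥ 0`), so the printed single inequality is the whole requirement.
[cite: Hintz2026, l.5061] -/
theorem piC_faster_bounds {v e γ eU γU : ℝ} (hv : v < 1) (he0 : 0 < e) (hγ : 0 < γ)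
    (heU0 : 0 < eU) (hγU : 0 < γU) :
    ((1 - e) * (1 - v) * γ ≤ (1 - v) * γ ∧ (1 - v) * γ ≤ 2 * (1 - v) * γ) ∧
      ((1 - eU) * γU ≤ γU ∧ γU ≤ 2 * γU) := by
  have h1 : 0 < (1 - v) * γ := by nlinarith
  refine ⟨⟨by nlinarith, by nlinarith⟩, ⟨by nlinarith, by nlinarith⟩⟩

/-- **The weight window (5.x) `EqEx0ells`** (l.5176–5179): `ℓ₀^♭ > 1`, `1 < ℓ_𝒥^♭ < min(ℓ₀^♭, 1+(1−e^Υ)γ^Υ, 3/2)`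
is inhabited iff `ℓ₀^♭ > 1` and `(1−e^Υ)γ^Υ > 0` (the latter holds under `EqExOpParam`).
[cite: Hintz2026, eq. (EqEx0ells) TeX l.5176-5179] -/
theorem ells_window_nonempty {ℓ₀ x : ℝ} :
    (∃ ℓI : ℝ, 1 < ℓI ∧ ℓI < min ℓ₀ (min (1 + x) (3 / 2))) ↔ (1 < ℓ₀ ∧ 0 < x) := by
  constructor
  · rintro ⟨ℓI, h1, h2⟩
    have ha := lt_of_lt_of_le h2 (min_le_left _ _)
    have hb := lt_of_lt_of_le (lt_of_lt_of_le h2 (min_le_right _ _)) (min_le_left _ _)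
    exact ⟨h1.trans ha, by linarith⟩
  · rintro ⟨h0, hx⟩
    refine ⟨1 + min (ℓ₀ - 1) (min x (1 / 2)) / 2, ?_, ?_⟩
    · have : 0 < min (ℓ₀ - 1) (min x (1 / 2)) := lt_min (by linarith) (lt_min hx (by norm_num))
      linarith
    · have h1 : min (ℓ₀ - 1) (min x (1 / 2)) ≤ ℓ₀ - 1 := min_le_left _ _
      have h2 : min (ℓ₀ - 1) (min x (1 / 2)) ≤ x := (min_le_right _ _).trans (min_le_left _ _)
      have h3 : min (ℓ₀ - 1) (min x (1 / 2)) ≤ 1 / 2 := (min_le_right _ _).trans (min_le_right _ _)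
      have h4 : 0 < min (ℓ₀ - 1) (min x (1 / 2)) := lt_min (by linarith) (lt_min hx (by norm_num))
      simp only [lt_min_iff]
      refine ⟨by linarith, by linarith, by linarith⟩

/-- **[Hintz2023]'s window, shifted by one.**  HM Def 3.20 / Cor 3.36 (HM l.1557, l.2359): `ℓ_𝒥 <
min(−γ^Υ_[HM], ℓ₀, ½)`, `ℓ_𝒥 > 0` (and `ℓ₀ > 0`) for the perturbation `r^{-1}h`; with `ℓ^♭ := ℓ + 1` (the `r^{-1}
= ρ₀ρ_𝒥` prefactor) and `−γ^Υ_[HM] = (1−e^Υ)γ^Υ =: x` this is literally Hintz 2026's (EqEx0ells) clause for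
`ℓ_𝒥^♭`. [cite: Hintz2023, Def 3.20 (l.1557) and Cor 3.36 (l.2359); Hintz2026, eq. (EqEx0ells) l.5176-5179] -/
theorem hm4g_window_shift (ℓ₀ ℓI x : ℝ) :
    (0 < ℓI ∧ ℓI < min x (min ℓ₀ (1 / 2))) ↔
      (1 < ℓI + 1 ∧ ℓI + 1 < min (ℓ₀ + 1) (min (1 + x) (3 / 2))) := by
  simp only [lt_min_iff]
  constructor
  · rintro ⟨h0, hx, hl, hh⟩; exact ⟨by linarith, by linarith, by linarith, by linarith⟩
  · rintro ⟨h0, hl, hx, hh⟩; exact ⟨by linarith, by linarith, by linarith, by linarith⟩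

end Hintz2026.ExteriorNormalOperator

end Literature.Geometry.Lorentzian
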